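import Summits.Ventures.DiscreteObjects.Hadamard.Order49Structure668
import Summits.Ventures.DiscreteObjects.Hadamard.ElemAbelianRank2Small

/-!
# Hadamard 668 census, family F12 — structure of (hypothetical) automorphisms of order 25 and 9 of an H(668) (kernel)

Framing: lottery ticket; floor = certified bounds/negative ranges.

Cell pub-namedobj (venture DiscreteObjects), target (H), hadamard gen 17.  The prime-square line of the census:
`p² ∣ orderOf` is EXCLUDED for `p ≥ 11` (`PrimeSquareOrder`, gen 11), an element of pair-order `49` fixes exactly
`10 + 10` and its 7th power `80 + 80` (`Order49FixedTen668`, gen 17).  This file records the analogous STRUCTURE for the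
two remaining primes (no exclusion):
* **`hadamard668_order25_structure`**: `π^25 = κ^25 = 1`, `(π^5, κ^5) ≠ (1, 1)` ⇒ `π^5`, `κ^5` fix `18` or `68`
  rows / columns (`census5` window `{8, 18, …, 108}` and `25 ∣ #moved(κ^5)` by `sq_dvd_card_moved`), and `π`, `κ` fix
  `3`, `8`, `13`, `18` or `23` rows / columns, at most `#Fix(κ^5)` [free ℤ/25-orbit of a row moved by `π^5`
  (`free_of_moved_pow`, `cyclic_free_orbit_bound`): `25·#Fix(κ) ≤ 668`; `#Fix(κ) ≡ 668 ≡ 3 (mod 5)`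
  (`Equiv.Perm.card_compl_support_modEq`)].  (The value `3` dies by (E3), `fixedRows_inner_dvd` of
  `Order49FixedTen668` — recorded separately once that module is built on the farm.)
* **`hadamard668_order9_structure`**: `π^9 = κ^9 = 1`, `(π^3, κ^3) ≠ (1, 1)` ⇒ `#Fix(κ^3) ≡ 2 (mod 18)`,
  `2 ≤ #Fix(κ^3) ≤ 164`, `#Fix(κ) ≤ 74`, `#Fix(κ) ≡ 2 (mod 3)`, `#Fix(κ) ≤ #Fix(κ^3)`; rows likewise.
Ours, not literature; no `sorry`.
-/

namespace Summit.Ventures.DiscreteObjects.Hadamard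

open Finset BigOperators Matrix

open Literature.Combinatorics.Designs.GoethalsSeidel (IsHadamardMatrix)

variable {ι : Type*} [Fintype ι] [DecidableEq ι]

section psq
variable {H : Matrix ι ι ℤ}

/-- columns, order 25 -/
lemma order25_cols (hH : IsHadamardMatrix H) (hι : Fintype.card ι = 668)
    {π κ : Equiv.Perm ι} {d e : ι → ℤ} (haut : IsSignedAut H π κ d e)
    (hπ : π ^ 25 = 1) (hκ : κ ^ 25 = 1) (hπ5 : π ^ 5 ≠ 1) :
    ((univ.filter fun j => (κ ^ 5) j = j).card = 18 ∨ (univ.filter fun j => (κ ^ 5) j = j).card = 68) ∧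
    ((univ.filter fun j => κ j = j).card = 3 ∨ (univ.filter fun j => κ j = j).card = 8 ∨
      (univ.filter fun j => κ j = j).card = 13 ∨ (univ.filter fun j => κ j = j).card = 18 ∨
      (univ.filter fun j => κ j = j).card = 23) ∧
    (univ.filter fun j => κ j = j).card ≤ (univ.filter fun j => (κ ^ 5) j = j).card := by
  classical
  haveI hp5 : Fact (Nat.Prime 5) := ⟨by norm_num⟩
  have haut5 := isSignedAut_pow haut 5
  have hπ55 : (π ^ 5) ^ 5 = 1 := by rw [← pow_mul]; exact hπ
  have hκ55 : (κ ^ 5) ^ 5 = 1 := by rw [← pow_mul]; exact hκ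
  obtain ⟨⟨-, hcC, hcCm⟩, ⟨-, hcR, -⟩⟩ := census5 hH hι haut5 hπ55 hκ55 hπ5
  have hκ' : κ ^ (5 * 5) = 1 := hκ
  have hπ' : π ^ (5 * 5) = 1 := hπ
  have hdvdC := sq_dvd_card_moved κ (by norm_num : (5 : ℕ).Prime) hκ'
  have hsplitC := Finset.card_filter_add_card_filter_not (s := (univ : Finset ι)) (fun j => (κ ^ 5) j = j)
  rw [Finset.card_univ, hι] at hsplitC
  have eC : (univ.filter fun j => (κ ^ 5) j ≠ j) = univ.filter fun j => ¬ (κ ^ 5) j = j := rfl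
  rw [eC] at hdvdC
  obtain ⟨c, hc⟩ := hdvdC
  refine ⟨by omega, ?_, Finset.card_le_card (fixed_subset_fixed_pow κ 5)⟩
  -- a row moved by π^5 has π-period 25
  have hsplitR := Finset.card_filter_add_card_filter_not (s := (univ : Finset ι)) (fun i => (π ^ 5) i = i)
  rw [Finset.card_univ, hι] at hsplitR
  have hpos : 0 < (univ.filter fun i => ¬ (π ^ 5) i = i).card := by omega
  obtain ⟨x₁, hx₁⟩ := Finset.card_pos.mp hpos
  simp only [Finset.mem_filter, Finset.mem_univ, true_and] at hx₁
  have hfree := free_of_moved_pow π (by norm_num : (5 : ℕ).Prime) hπ' hx₁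
  have hbound := cyclic_free_orbit_bound hH haut (by decide : Odd (5 * 5)) hπ' hκ' x₁ hfree
  rw [hι] at hbound
  have hm := Equiv.Perm.card_compl_support_modEq (p := 5) (n := 2) (σ := κ) hκ
  have eS : κ.supportᶜ = univ.filter fun x => κ x = x := by
    ext x; simp [Equiv.Perm.mem_support]
  rw [eS, hι] at hm
  unfold Nat.ModEq at hm
  omega

/-- **structure of an automorphism of order 25 of an H(668)**: for a signed automorphism `(π, κ, d, e)` with
`π^25 = κ^25 = 1` and `(π^5, κ^5) ≠ (1, 1)`: the fifth powers fix `18` or `68` rows / columns, and `π`, `κ` fix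
`3, 8, 13, 18` or `23` rows / columns, at most as many as their fifth powers. -/
theorem hadamard668_order25_structure (hH : IsHadamardMatrix H) (hι : Fintype.card ι = 668)
    (π κ : Equiv.Perm ι) (d e : ι → ℤ) (haut : IsSignedAut H π κ d e)
    (hπ : π ^ 25 = 1) (hκ : κ ^ 25 = 1) (hne : π ^ 5 ≠ 1 ∨ κ ^ 5 ≠ 1) :
    ((univ.filter fun i => (π ^ 5) i = i).card = 18 ∨ (univ.filter fun i => (π ^ 5) i = i).card = 68) ∧
    ((univ.filter fun j => (κ ^ 5) j = j).card = 18 ∨ (univ.filter fun j => (κ ^ 5) j = j).card = 68) ∧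
    ((univ.filter fun i => π i = i).card = 3 ∨ (univ.filter fun i => π i = i).card = 8 ∨
      (univ.filter fun i => π i = i).card = 13 ∨ (univ.filter fun i => π i = i).card = 18 ∨
      (univ.filter fun i => π i = i).card = 23) ∧
    ((univ.filter fun j => κ j = j).card = 3 ∨ (univ.filter fun j => κ j = j).card = 8 ∨
      (univ.filter fun j => κ j = j).card = 13 ∨ (univ.filter fun j => κ j = j).card = 18 ∨
      (univ.filter fun j => κ j = j).card = 23) ∧
    (univ.filter fun i => π i = i).card ≤ (univ.filter fun i => (π ^ 5) i = i).card ∧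
    (univ.filter fun j => κ j = j).card ≤ (univ.filter fun j => (κ ^ 5) j = j).card := by
  have hcard : (Fintype.card ι : ℤ) ≠ 0 := by rw [hι]; norm_num
  have hHt : IsHadamardMatrix Hᵀ := isHadamard_transpose hH hcard
  have haut5 := isSignedAut_pow haut 5
  have hπ55 : (π ^ 5) ^ 5 = 1 := by rw [← pow_mul]; exact hπ
  have hκ55 : (κ ^ 5) ^ 5 = 1 := by rw [← pow_mul]; exact hκ
  have hπ5 : π ^ 5 ≠ 1 := by
    rcases hne with h | h
    · exact h
    · intro h5; apply h; rw [h5] at haut5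
      exact signedAut_snd_eq_one H hH hcard haut5 (by decide : Odd 5) hκ55
  have hκ5 : κ ^ 5 ≠ 1 := by
    intro h5; apply hπ5
    have ht := isSignedAut_transpose haut5
    rw [h5] at ht
    exact signedAut_snd_eq_one Hᵀ hHt hcard ht (by decide : Odd 5) hπ55
  obtain ⟨fC, hC, hleC⟩ := order25_cols hH hι haut hπ hκ hπ5
  obtain ⟨fR, hR, hleR⟩ := order25_cols hHt hι (isSignedAut_transpose haut) hκ hπ hκ5
  exact ⟨fR, fC, hR, hC, hleR, hleC⟩

/-- columns, order 9 -/
lemma order9_cols (hH : IsHadamardMatrix H) (hι : Fintype.card ι = 668)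
    {π κ : Equiv.Perm ι} {d e : ι → ℤ} (haut : IsSignedAut H π κ d e)
    (hπ : π ^ 9 = 1) (hκ : κ ^ 9 = 1) (hπ3 : π ^ 3 ≠ 1) :
    (univ.filter fun j => (κ ^ 3) j = j).card % 18 = 2 ∧ 2 ≤ (univ.filter fun j => (κ ^ 3) j = j).card ∧
    (univ.filter fun j => (κ ^ 3) j = j).card ≤ 164 ∧
    (univ.filter fun j => κ j = j).card ≤ 74 ∧ (univ.filter fun j => κ j = j).card % 3 = 2 ∧
    (univ.filter fun j => κ j = j).card ≤ (univ.filter fun j => (κ ^ 3) j = j).card := by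
  classical
  haveI hp3 : Fact (Nat.Prime 3) := ⟨by norm_num⟩
  have haut3 := isSignedAut_pow haut 3
  have hπ33 : (π ^ 3) ^ 3 = 1 := by rw [← pow_mul]; exact hπ
  have hκ33 : (κ ^ 3) ^ 3 = 1 := by rw [← pow_mul]; exact hκ
  obtain ⟨⟨hcC1, hcC2, hcCm⟩, ⟨-, hcR, -⟩⟩ := census3 hH hι haut3 hπ33 hκ33 hπ3
  have hκ' : κ ^ (3 * 3) = 1 := hκ
  have hπ' : π ^ (3 * 3) = 1 := hπ
  have hdvdC := sq_dvd_card_moved κ (by norm_num : (3 : ℕ).Prime) hκ'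
  have hsplitC := Finset.card_filter_add_card_filter_not (s := (univ : Finset ι)) (fun j => (κ ^ 3) j = j)
  rw [Finset.card_univ, hι] at hsplitC
  have eC : (univ.filter fun j => (κ ^ 3) j ≠ j) = univ.filter fun j => ¬ (κ ^ 3) j = j := rfl
  rw [eC] at hdvdC
  obtain ⟨c, hc⟩ := hdvdC
  have hsplitR := Finset.card_filter_add_card_filter_not (s := (univ : Finset ι)) (fun i => (π ^ 3) i = i)
  rw [Finset.card_univ, hι] at hsplitR
  have hpos : 0 < (univ.filter fun i => ¬ (π ^ 3) i = i).card := by omega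
  obtain ⟨x₁, hx₁⟩ := Finset.card_pos.mp hpos
  simp only [Finset.mem_filter, Finset.mem_univ, true_and] at hx₁
  have hfree := free_of_moved_pow π (by norm_num : (3 : ℕ).Prime) hπ' hx₁
  have hbound := cyclic_free_orbit_bound hH haut (by decide : Odd (3 * 3)) hπ' hκ' x₁ hfree
  rw [hι] at hbound
  have hm := Equiv.Perm.card_compl_support_modEq (p := 3) (n := 2) (σ := κ) hκ
  have eS : κ.supportᶜ = univ.filter fun x => κ x = x := by
    ext x; simp [Equiv.Perm.mem_support]
  rw [eS, hι] at hm
  unfold Nat.ModEq at hm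
  refine ⟨by omega, hcC1, hcC2, by omega, by omega, Finset.card_le_card (fixed_subset_fixed_pow κ 3)⟩

/-- **structure of an automorphism of order 9 of an H(668)**: for a signed automorphism `(π, κ, d, e)` with
`π^9 = κ^9 = 1` and `(π^3, κ^3) ≠ (1, 1)`: the cubes fix `f ≡ 2 (mod 18)` rows / columns, `2 ≤ f ≤ 164`, and `π`, `κ`
fix at most `74` rows / columns, `≡ 2 (mod 3)`, at most as many as their cubes. -/
theorem hadamard668_order9_structure (hH : IsHadamardMatrix H) (hι : Fintype.card ι = 668)
    (π κ : Equiv.Perm ι) (d e : ι → ℤ) (haut : IsSignedAut H π κ d e)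
    (hπ : π ^ 9 = 1) (hκ : κ ^ 9 = 1) (hne : π ^ 3 ≠ 1 ∨ κ ^ 3 ≠ 1) :
    ((univ.filter fun i => (π ^ 3) i = i).card % 18 = 2 ∧ 2 ≤ (univ.filter fun i => (π ^ 3) i = i).card ∧
      (univ.filter fun i => (π ^ 3) i = i).card ≤ 164 ∧
      (univ.filter fun i => π i = i).card ≤ 74 ∧ (univ.filter fun i => π i = i).card % 3 = 2 ∧
      (univ.filter fun i => π i = i).card ≤ (univ.filter fun i => (π ^ 3) i = i).card) ∧
    ((univ.filter fun j => (κ ^ 3) j = j).card % 18 = 2 ∧ 2 ≤ (univ.filter fun j => (κ ^ 3) j = j).card ∧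
      (univ.filter fun j => (κ ^ 3) j = j).card ≤ 164 ∧
      (univ.filter fun j => κ j = j).card ≤ 74 ∧ (univ.filter fun j => κ j = j).card % 3 = 2 ∧
      (univ.filter fun j => κ j = j).card ≤ (univ.filter fun j => (κ ^ 3) j = j).card) := by
  have hcard : (Fintype.card ι : ℤ) ≠ 0 := by rw [hι]; norm_num
  have hHt : IsHadamardMatrix Hᵀ := isHadamard_transpose hH hcard
  have haut3 := isSignedAut_pow haut 3
  have hπ33 : (π ^ 3) ^ 3 = 1 := by rw [← pow_mul]; exact hπ
  have hκ33 : (κ ^ 3) ^ 3 = 1 := by rw [← pow_mul]; exact hκ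
  have hπ3 : π ^ 3 ≠ 1 := by
    rcases hne with h | h
    · exact h
    · intro h3; apply h; rw [h3] at haut3
      exact signedAut_snd_eq_one H hH hcard haut3 (by decide : Odd 3) hκ33
  have hκ3 : κ ^ 3 ≠ 1 := by
    intro h3; apply hπ3
    have ht := isSignedAut_transpose haut3
    rw [h3] at ht
    exact signedAut_snd_eq_one Hᵀ hHt hcard ht (by decide : Odd 3) hπ33
  exact ⟨order9_cols hHt hι (isSignedAut_transpose haut) hκ hπ hκ3, order9_cols hH hι haut hπ hκ hπ3⟩

end psq

end Summit.Ventures.DiscreteObjects.Hadamard
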